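import Literature.Analysis.Complex.CauchyPompeiu
import Literature.Analysis.Complex.CircleResidue
import Literature.Analysis.Complex.WeylLemmaDbar
import HarnessLib

/-!
# Pairing `∂̄` of a cut-off against a meromorphic function computes the residue

Topic `Literature/Analysis/Complex`. Let `χ ∈ C¹_c(ℂ)` be a cut-off with `χ = 1` on a
neighbourhood of a point `c`, and let `f` be holomorphic on `U ∖ {c}` for an open `U ⊇ supp χ`,
`c ∈ U`, and meromorphic at `c`. Then (`∂̄ = ∂/∂z̄ = ½(∂ₓ + i∂_y)`, the tree's `dbarAlong 1`;
`dA` = Lebesgue measure on `ℂ`)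

  `∫_ℂ (∂̄χ) · f dA = -π · Res_c f`            (`integral_dbarAlong_mul_eq_neg_pi_mul_residueAt`).

This is the computation behind the residue theorem on a compact Riemann surface in its
`∂̄`/Stokes form (one replaces a meromorphic `1`-form `η` by the smooth form `(1 - χ) η` and reads
`∫ d((1 - χ)η) = -∫ dχ ∧ η` in a chart), and Hörmander's device in the proof of Thm. 1.2.4:
for `u` holomorphic and `ψ = 1` near `K`, Thm. 1.2.1 (the generalized Cauchy integral formula
(1.2.3)) applied to `ψu` gives (1.2.5) `ψ(ζ)u(ζ) = (2πi)⁻¹ ∫ u ∂ψ/∂z̄ (z - ζ)⁻¹ dz ∧ dz̄`, and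
"differentiation of (1.2.5)" gives the higher Cauchy kernels. Here, with `dz ∧ dz̄ = -2i dA`:

* `integral_dbarAlong_mul_inv_sub_eq` — `∫ ∂̄φ(s) (s - c)⁻¹ dA = -π φ(c)` for `φ ∈ C¹_c`
  (the tree's Cauchy–Pompeiu formula `integral_inv_smul_dbarAlong_sub`, Hörmander (1.2.3) with
  `∂ω` off `supp φ`, after the reflection `t ↦ c - t`);
* `integral_dbarAlong_mul_eq_zero_of_differentiableOn` — `∫ ∂̄χ · g dA = 0` for `g` holomorphic on
  a neighbourhood of `supp χ` ((1.2.5) for `u = (z - c) g` at `ζ = c`);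
* `integral_dbarAlong_mul_zpow_sub_eq` — `∫ ∂̄χ (s - c)^m dA` does not depend on the cut-off
  `χ = 1` near `c` ((1.2.3) for `(χ₁ - χ₂)(z - c)^{m+1} ∈ C¹_c`, which vanishes at `c`);
* `integral_dbarAlong_mul_zpow_sub_eq_zero` — `∫ ∂̄χ (s - c)^m dA = 0` for `m ≠ -1` (compare `χ`
  with the dilated cut-off `χ(c + (s - c)/2)`: the integral is multiplied by `2^{m+1} ≠ 1`);
* `integral_dbarAlong_mul_eq_neg_pi_mul_residueAt` — the displayed formula, by splitting off the
  principal part of `f` at `c` (`exists_principalPart`, `residueAt_eq_of_principalPart` of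
  `CircleResidue.lean`) and extending `f - (principal part)` holomorphically across `c`.

Everything is proved; there are no definitions and no named facts.

## References

* L. Hörmander, *An Introduction to Complex Analysis in Several Variables*, 2nd ed. (1973), §1.2:
  Thm. 1.2.1 (formula (1.2.3)) and the proof of Thm. 1.2.4 (formula (1.2.5)). Held text
  `book:hormander1973-introduction-complex-analysis-several-variables`, pp. 10–12. [HormanderSCV1973]
-/

noncomputable section

open MeasureTheory Set Filter Function Complex Metric Topology
open scoped Real

namespace Literature.Analysis.Complex

/-! ### Regularity and support of `∂̄χ` -/

/-- `∂̄χ` is continuous for `χ ∈ C¹`. [folklore] -/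
theorem continuous_dbarAlong_one {χ : ℂ → ℂ} (hχ : ContDiff ℝ 1 χ) :
    Continuous (dbarAlong 1 χ) := by
  have hc : Continuous (fderiv ℝ χ) := hχ.continuous_fderiv one_ne_zero
  have h : dbarAlong 1 χ = fun z ↦ (2 : ℂ)⁻¹ • (fderiv ℝ χ z 1 + I • fderiv ℝ χ z I) := by
    funext z; rw [dbarAlong_one]
  rw [h]
  exact ((hc.clm_apply continuous_const).add
    ((hc.clm_apply continuous_const).const_smul I)).const_smul ((2 : ℂ)⁻¹)

/-- The support of `∂̄χ` lies in the support of `Dχ`. [folklore] -/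
theorem support_dbarAlong_one_subset (χ : ℂ → ℂ) :
    support (dbarAlong 1 χ) ⊆ support (fderiv ℝ χ) := by
  intro z hz h0
  apply hz
  simp [dbarAlong_one, h0]

/-- The closed support of `∂̄χ` lies in the closed support of `χ`. [folklore] -/
theorem tsupport_dbarAlong_one_subset (χ : ℂ → ℂ) :
    tsupport (dbarAlong 1 χ) ⊆ tsupport χ :=
  (closure_mono (support_dbarAlong_one_subset χ)).trans (tsupport_fderiv_subset ℝ)

/-- `∂̄χ` has compact support if `χ` has. [folklore] -/
theorem hasCompactSupport_dbarAlong_one {χ : ℂ → ℂ} (hχc : HasCompactSupport χ) :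
    HasCompactSupport (dbarAlong 1 χ) :=
  (hχc.fderiv (𝕜 := ℝ)).mono (support_dbarAlong_one_subset χ)

/-- `∂̄χ` vanishes near a point around which `χ` is constant. [folklore] -/
theorem dbarAlong_eventuallyEq_zero_of_eventuallyEq_const {χ : ℂ → ℂ} {c a : ℂ}
    (h : χ =ᶠ[𝓝 c] fun _ ↦ a) : dbarAlong 1 χ =ᶠ[𝓝 c] fun _ ↦ 0 := by
  obtain ⟨V, hV, hVo, hcV⟩ := _root_.eventually_nhds_iff.1 h
  refine _root_.eventually_nhds_iff.2 ⟨V, fun z hz ↦ ?_, hVo, hcV⟩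
  exact dbarAlong_eq_zero_of_eventuallyEq_const
    (_root_.eventually_nhds_iff.2 ⟨V, fun w hw ↦ hV w hw, hVo, hz⟩)

/-- **Continuity of `∂̄χ · v` across the singular point.** If `χ ∈ C¹` is constant near `c` and
`v` is continuous off `c`, then `s ↦ ∂̄χ(s) v(s)` is continuous on `ℂ` (it vanishes near `c`).
[folklore] -/
theorem continuous_dbarAlong_mul {χ v : ℂ → ℂ} {c a : ℂ} (hχ : ContDiff ℝ 1 χ)
    (h1 : χ =ᶠ[𝓝 c] fun _ ↦ a) (hv : ContinuousOn v {c}ᶜ) :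
    Continuous fun s ↦ dbarAlong 1 χ s * v s := by
  rw [continuous_iff_continuousAt]
  intro s
  by_cases hs : s = c
  · subst hs
    have h0 : (fun s ↦ dbarAlong 1 χ s * v s) =ᶠ[𝓝 s] fun _ ↦ 0 := by
      filter_upwards [dbarAlong_eventuallyEq_zero_of_eventuallyEq_const h1] with z hz
      rw [hz, zero_mul]
    exact (continuousAt_const.congr h0.symm)
  · exact ((continuous_dbarAlong_one hχ).continuousAt).mul
      (hv.continuousAt (isOpen_compl_singleton.mem_nhds hs))

/-- **Continuity of `∂̄χ · v` for `v` continuous near `supp χ`**: if `χ ∈ C¹`, `supp χ ⊆ U`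
open and `v` is continuous on `U`, then `s ↦ ∂̄χ(s) v(s)` is continuous on `ℂ`. [folklore] -/
theorem continuous_dbarAlong_mul_of_tsupport_subset {χ v : ℂ → ℂ} {U : Set ℂ} (hU : IsOpen U)
    (hχ : ContDiff ℝ 1 χ) (hχU : tsupport χ ⊆ U) (hv : ContinuousOn v U) :
    Continuous fun s ↦ dbarAlong 1 χ s * v s := by
  rw [continuous_iff_continuousAt]
  intro s
  by_cases hs : s ∈ U
  · exact ((continuous_dbarAlong_one hχ).continuousAt).mul (hv.continuousAt (hU.mem_nhds hs))
  · have hs' : s ∉ tsupport χ := fun h ↦ hs (hχU h)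
    have h0 : (fun s ↦ dbarAlong 1 χ s * v s) =ᶠ[𝓝 s] fun _ ↦ 0 := by
      filter_upwards [(isClosed_tsupport χ).isOpen_compl.mem_nhds hs'] with z hz
      rw [dbarAlong_eq_zero_of_notMem_tsupport hz, zero_mul]
    exact (continuousAt_const.congr h0.symm)

/-- `∂̄χ · v` has compact support if `χ` has. [folklore] -/
theorem hasCompactSupport_dbarAlong_mul {χ : ℂ → ℂ} (hχc : HasCompactSupport χ) (v : ℂ → ℂ) :
    HasCompactSupport fun s ↦ dbarAlong 1 χ s * v s :=
  (hasCompactSupport_dbarAlong_one hχc).mul_right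

/-- `∂̄χ · v` is integrable if `χ ∈ C¹_c` is constant near `c` and `v` is continuous off `c`.
[folklore] -/
theorem integrable_dbarAlong_mul {χ v : ℂ → ℂ} {c a : ℂ} (hχ : ContDiff ℝ 1 χ)
    (hχc : HasCompactSupport χ) (h1 : χ =ᶠ[𝓝 c] fun _ ↦ a) (hv : ContinuousOn v {c}ᶜ) :
    Integrable fun s ↦ dbarAlong 1 χ s * v s :=
  (continuous_dbarAlong_mul hχ h1 hv).integrable_of_hasCompactSupport
    (hasCompactSupport_dbarAlong_mul hχc v)

/-- `∂̄χ` vanishes off an open set containing the closed support of `χ`. [folklore] -/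
theorem dbarAlong_eq_zero_of_notMem {χ : ℂ → ℂ} {U : Set ℂ} (hχU : tsupport χ ⊆ U) {s : ℂ}
    (hs : s ∉ U) : dbarAlong 1 χ s = 0 :=
  dbarAlong_eq_zero_of_notMem_tsupport fun h ↦ hs (hχU h)

/-! ### `C¹` products of a cut-off with a function regular near its support -/

/-- A product `χ · g` with `χ ∈ C¹_c`, `supp χ ⊆ U` open and `g ∈ C¹(U)` is `C¹` on `ℂ`.
[folklore] -/
theorem contDiff_mul_of_tsupport_subset {χ g : ℂ → ℂ} {U : Set ℂ} (hU : IsOpen U)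
    (hχ : ContDiff ℝ 1 χ) (hχU : tsupport χ ⊆ U) (hg : ContDiffOn ℝ 1 g U) :
    ContDiff ℝ 1 fun s ↦ χ s * g s := by
  rw [contDiff_iff_contDiffAt]
  intro s
  by_cases hs : s ∈ U
  · exact hχ.contDiffAt.mul (hg.contDiffAt (hU.mem_nhds hs))
  · have hs' : s ∉ tsupport χ := fun h ↦ hs (hχU h)
    have h0 : (fun s ↦ χ s * g s) =ᶠ[𝓝 s] fun _ ↦ 0 := by
      filter_upwards [(isClosed_tsupport χ).isOpen_compl.mem_nhds hs'] with z hz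
      rw [image_eq_zero_of_notMem_tsupport hz, zero_mul]
    exact contDiffAt_const.congr_of_eventuallyEq h0

/-- Holomorphic functions on an open set are `C¹` over `ℝ` there. [folklore] -/
private theorem contDiffOn_real_one_of_differentiableOn {g : ℂ → ℂ} {U : Set ℂ} (hU : IsOpen U)
    (hg : DifferentiableOn ℂ g U) : ContDiffOn ℝ 1 g U :=
  ((hg.analyticOnNhd hU).contDiffOn hU.uniqueDiffOn (n := 1)).restrict_scalars ℝ

/-! ### Cauchy–Pompeiu in residue form -/

/-- **Cauchy–Pompeiu, residue form**: for `φ ∈ C¹_c(ℂ)` and `c ∈ ℂ`,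
`∫ ∂̄φ(s) (s - c)⁻¹ dA(s) = -π φ(c)` (Hörmander (1.2.3) with `∂ω` off `supp φ`, i.e. the tree's
`integral_inv_smul_dbarAlong_sub`, after `t ↦ c - t`; `dz ∧ dz̄ = -2i dA`).
[cite: HormanderSCV1973, Thm. 1.2.1] -/
theorem integral_dbarAlong_mul_inv_sub_eq {φ : ℂ → ℂ} (hφ : ContDiff ℝ 1 φ)
    (hφc : HasCompactSupport φ) (c : ℂ) :
    ∫ s, dbarAlong 1 φ s * (s - c)⁻¹ = -π * φ c := by
  have hP := integral_inv_smul_dbarAlong_sub hφ hφc c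
  -- reflect `t ↦ c - t`
  have hrefl : ∫ t : ℂ, (↑π * t)⁻¹ • dbarAlong 1 φ (c - t) =
      ∫ s : ℂ, (↑π * (c - s))⁻¹ * dbarAlong 1 φ s := by
    have h := integral_sub_left_eq_self (fun s : ℂ ↦ (↑π * (c - s))⁻¹ * dbarAlong 1 φ s) volume c
    simp only [sub_sub_cancel, smul_eq_mul] at h ⊢
    exact h
  rw [hrefl] at hP
  have hπ : (π : ℂ) ≠ 0 := ofReal_ne_zero.2 Real.pi_ne_zero
  have key : ∀ s : ℂ, (-π : ℂ) * (↑π * (c - s))⁻¹ = (s - c)⁻¹ := fun s ↦ by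
    rw [mul_inv, ← mul_assoc, neg_mul, mul_inv_cancel₀ hπ, neg_one_mul, neg_inv, neg_sub]
  calc ∫ s, dbarAlong 1 φ s * (s - c)⁻¹
      = ∫ s, (-π : ℂ) * ((↑π * (c - s))⁻¹ * dbarAlong 1 φ s) := by
        congr 1
        funext s
        rw [← mul_assoc, key s, mul_comm]
    _ = -π * φ c := by rw [integral_const_mul, hP]

/-! ### Holomorphic functions pair to zero with `∂̄χ` -/

/-- **`∫ ∂̄χ · g dA = 0` for `g` holomorphic near `supp χ`** (`χ ∈ C¹_c`, `supp χ ⊆ U` open,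
`g` holomorphic on `U`): Hörmander's (1.2.5) for `u = (z - c) g` at `ζ = c`, i.e. Cauchy–Pompeiu
for the `C¹_c` function `χ g (z - c)`, whose `∂̄` is `∂̄χ · g (z - c)` and which vanishes at `c`.
[cite: HormanderSCV1973, proof of Thm. 1.2.4, (1.2.5)] -/
theorem integral_dbarAlong_mul_eq_zero_of_differentiableOn {χ g : ℂ → ℂ} {U : Set ℂ}
    (hU : IsOpen U) (hχ : ContDiff ℝ 1 χ) (hχc : HasCompactSupport χ) (hχU : tsupport χ ⊆ U)
    (hg : DifferentiableOn ℂ g U) : ∫ s, dbarAlong 1 χ s * g s = 0 := by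
  set c : ℂ := 0 with hc
  -- the auxiliary `C¹_c` function `φ = χ · (g · (z - c))`
  set u : ℂ → ℂ := fun s ↦ g s * (s - c) with hu
  have huU : DifferentiableOn ℂ u U := hg.mul ((differentiableOn_id).sub_const c)
  set φ : ℂ → ℂ := fun s ↦ χ s * u s with hφ_def
  have hφ : ContDiff ℝ 1 φ :=
    contDiff_mul_of_tsupport_subset hU hχ hχU (contDiffOn_real_one_of_differentiableOn hU huU)
  have hφc : HasCompactSupport φ := hχc.mul_right
  -- `∂̄φ = ∂̄χ · u` everywhere
  have hdbar : ∀ s, dbarAlong 1 φ s = dbarAlong 1 χ s * u s := by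
    intro s
    by_cases hs : s ∈ U
    · have hud : DifferentiableAt ℂ u s := huU.differentiableAt (hU.mem_nhds hs)
      rw [hφ_def, dbarAlong_one_mul (hχ.differentiable one_ne_zero s)
        (hud.restrictScalars ℝ), dbarAlong_eq_zero_of_differentiableAt hud, mul_zero, add_zero]
    · have hφU : tsupport φ ⊆ U := (tsupport_mul_subset_left).trans hχU
      rw [dbarAlong_eq_zero_of_notMem hφU hs, dbarAlong_eq_zero_of_notMem hχU hs, zero_mul]
  have hP := integral_dbarAlong_mul_inv_sub_eq hφ hφc c
  have hφ0 : φ c = 0 := by simp [hφ_def, hu]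
  rw [hφ0, mul_zero] at hP
  -- the integrands agree off `c`
  have hae : (fun s ↦ dbarAlong 1 φ s * (s - c)⁻¹) =ᵐ[volume] fun s ↦ dbarAlong 1 χ s * g s := by
    have hc0 : ∀ᵐ s ∂(volume : Measure ℂ), s ∈ ({c}ᶜ : Set ℂ) :=
      compl_mem_ae_iff.2 (measure_singleton c)
    filter_upwards [hc0] with s hs
    have hs' : s - c ≠ 0 := sub_ne_zero.2 hs
    rw [hdbar, hu]
    field_simp
  rw [← integral_congr_ae hae, hP]

/-! ### Powers `(s - c)^m`: independence of the cut-off and vanishing for `m ≠ -1` -/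

/-- The function `s ↦ (s - c)^m` (`m ∈ ℤ`) is `C¹` over `ℝ` away from `c`. [folklore] -/
theorem contDiffAt_real_zpow_sub {c s : ℂ} (hs : s ≠ c) (m : ℤ) :
    ContDiffAt ℝ 1 (fun s : ℂ ↦ (s - c) ^ m) s := by
  have hs' : s - c ≠ 0 := sub_ne_zero.2 hs
  have h : ContDiffAt ℂ 1 (fun s : ℂ ↦ (s - c) ^ m) s := by
    rcases Int.eq_nat_or_neg m with ⟨k, rfl | rfl⟩
    · simp_rw [zpow_natCast]
      exact (contDiffAt_id.sub contDiffAt_const).pow k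
    · simp_rw [zpow_neg, zpow_natCast]
      exact ((contDiffAt_id.sub contDiffAt_const).pow k).inv (pow_ne_zero _ hs')
  exact h.restrict_scalars ℝ

/-- The function `s ↦ (s - c)^m` (`m ∈ ℤ`) is holomorphic away from `c`. [folklore] -/
theorem differentiableAt_zpow_sub {c s : ℂ} (hs : s ≠ c) (m : ℤ) :
    DifferentiableAt ℂ (fun s : ℂ ↦ (s - c) ^ m) s :=
  ((differentiableAt_id.sub_const c).zpow (Or.inl (sub_ne_zero.2 hs)))

/-- `s ↦ (s - c)^m` is continuous off `c`. [folklore] -/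
theorem continuousOn_zpow_sub_compl (c : ℂ) (m : ℤ) :
    ContinuousOn (fun s : ℂ ↦ (s - c) ^ m) {c}ᶜ := fun _ hs ↦
  (differentiableAt_zpow_sub hs m).continuousAt.continuousWithinAt

/-- **Independence of the cut-off.** For two cut-offs `χ₁, χ₂ ∈ C¹_c(ℂ)` both `= 1` near `c`
and every `m ∈ ℤ`, `∫ ∂̄χ₁ (s - c)^m dA = ∫ ∂̄χ₂ (s - c)^m dA`: Cauchy–Pompeiu (1.2.3) for the
`C¹_c` function `(χ₁ - χ₂)(s - c)^{m+1}`, which vanishes near `c`.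
[cite: HormanderSCV1973, Thm. 1.2.1] -/
theorem integral_dbarAlong_mul_zpow_sub_eq {χ₁ χ₂ : ℂ → ℂ} {c : ℂ} (h₁ : ContDiff ℝ 1 χ₁)
    (h₁c : HasCompactSupport χ₁) (h₁1 : χ₁ =ᶠ[𝓝 c] fun _ ↦ 1) (h₂ : ContDiff ℝ 1 χ₂)
    (h₂c : HasCompactSupport χ₂) (h₂1 : χ₂ =ᶠ[𝓝 c] fun _ ↦ 1) (m : ℤ) :
    ∫ s, dbarAlong 1 χ₁ s * (s - c) ^ m = ∫ s, dbarAlong 1 χ₂ s * (s - c) ^ m := by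
  set ψ : ℂ → ℂ := fun s ↦ χ₁ s - χ₂ s with hψ_def
  have hψ : ContDiff ℝ 1 ψ := h₁.sub h₂
  have hψ0 : ψ =ᶠ[𝓝 c] fun _ ↦ 0 := by
    filter_upwards [h₁1, h₂1] with s hs1 hs2
    simp [hψ_def, hs1, hs2]
  obtain ⟨V, hV, hVo, hcV⟩ := _root_.eventually_nhds_iff.1 hψ0
  set φ : ℂ → ℂ := fun s ↦ ψ s * (s - c) ^ (m + 1) with hφ_def
  -- `φ` vanishes on `V`
  have hφV : ∀ s ∈ V, φ =ᶠ[𝓝 s] fun _ ↦ 0 := fun s hs ↦ by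
    filter_upwards [hVo.mem_nhds hs] with z hz
    simp [hφ_def, hV z hz]
  have hφ : ContDiff ℝ 1 φ := by
    rw [contDiff_iff_contDiffAt]
    intro s
    by_cases hs : s ∈ V
    · exact contDiffAt_const.congr_of_eventuallyEq (hφV s hs)
    · have hsc : s ≠ c := fun h ↦ hs (h ▸ hcV)
      exact hψ.contDiffAt.mul (contDiffAt_real_zpow_sub hsc (m + 1))
  have hφc : HasCompactSupport φ := (h₁c.sub h₂c).mul_right
  -- `∂̄φ = ∂̄ψ (s - c)^{m+1}` everywhere
  have hdbar : ∀ s, dbarAlong 1 φ s = dbarAlong 1 ψ s * (s - c) ^ (m + 1) := by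
    intro s
    by_cases hs : s ∈ V
    · have hψs : ψ =ᶠ[𝓝 s] fun _ ↦ 0 := _root_.eventually_nhds_iff.2 ⟨V, hV, hVo, hs⟩
      rw [dbarAlong_eq_zero_of_eventuallyEq_const (hφV s hs),
        dbarAlong_eq_zero_of_eventuallyEq_const hψs, zero_mul]
    · have hsc : s ≠ c := fun h ↦ hs (h ▸ hcV)
      have hzd : DifferentiableAt ℂ (fun s : ℂ ↦ (s - c) ^ (m + 1)) s :=
        differentiableAt_zpow_sub hsc (m + 1)
      rw [hφ_def, dbarAlong_one_mul (hψ.differentiable one_ne_zero s)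
        (hzd.restrictScalars ℝ), dbarAlong_eq_zero_of_differentiableAt hzd, mul_zero, add_zero]
  have hP := integral_dbarAlong_mul_inv_sub_eq hφ hφc c
  have hφ0 : φ c = 0 := by simp [hφ_def, hV c hcV]
  rw [hφ0, mul_zero] at hP
  -- `∂̄ψ = ∂̄χ₁ - ∂̄χ₂`
  have hdψ : ∀ s, dbarAlong 1 ψ s = dbarAlong 1 χ₁ s - dbarAlong 1 χ₂ s := by
    intro s
    have hd1 : DifferentiableAt ℝ χ₁ s := h₁.differentiable one_ne_zero s
    have hd2 : DifferentiableAt ℝ χ₂ s := h₂.differentiable one_ne_zero s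
    simp only [hψ_def, dbarAlong_one, fderiv_fun_sub hd1 hd2]
    simp only [_root_.sub_apply, smul_eq_mul]
    ring
  -- the integrands agree off `c`
  have hae : (fun s ↦ dbarAlong 1 φ s * (s - c)⁻¹) =ᵐ[volume]
      fun s ↦ dbarAlong 1 χ₁ s * (s - c) ^ m - dbarAlong 1 χ₂ s * (s - c) ^ m := by
    have hc0 : ∀ᵐ s ∂(volume : Measure ℂ), s ∈ ({c}ᶜ : Set ℂ) :=
      compl_mem_ae_iff.2 (measure_singleton c)
    filter_upwards [hc0] with s hs
    have hs' : s - c ≠ 0 := sub_ne_zero.2 hs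
    rw [hdbar, hdψ, mul_assoc, ← zpow_sub_one₀ hs', add_sub_cancel_right, sub_mul]
  rw [integral_congr_ae hae, integral_sub
    (integrable_dbarAlong_mul h₁ h₁c h₁1 (continuousOn_zpow_sub_compl c m))
    (integrable_dbarAlong_mul h₂ h₂c h₂1 (continuousOn_zpow_sub_compl c m))] at hP
  exact sub_eq_zero.1 hP

/-- The dilated cut-off `χ(c + (s - c)/2)` of a `C¹` cut-off is `C¹`. [folklore] -/
theorem contDiff_comp_dilate {χ : ℂ → ℂ} (hχ : ContDiff ℝ 1 χ) (c : ℂ) :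
    ContDiff ℝ 1 fun s : ℂ ↦ χ (c + (2⁻¹ : ℝ) • (s - c)) :=
  hχ.comp (contDiff_const.add ((contDiff_id.sub contDiff_const).const_smul (2⁻¹ : ℝ)))

/-- The dilated cut-off has compact support (the dilation `s ↦ c + (s - c)/2` is a
homeomorphism of `ℂ`). [folklore] -/
theorem hasCompactSupport_comp_dilate {χ : ℂ → ℂ} (hχc : HasCompactSupport χ) (c : ℂ) :
    HasCompactSupport fun s : ℂ ↦ χ (c + (2⁻¹ : ℝ) • (s - c)) := by
  let e : ℂ ≃ₜ ℂ :=
    ((Homeomorph.subRight c).trans (Homeomorph.smulOfNeZero (2⁻¹ : ℝ) (by norm_num))).trans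
      (Homeomorph.addLeft c)
  have h := hχc.comp_homeomorph e
  have hfun : (χ ∘ e) = fun s : ℂ ↦ χ (c + (2⁻¹ : ℝ) • (s - c)) := by
    funext s; simp [e]
  rwa [hfun] at h

/-- The dilated cut-off is `= 1` near `c` if `χ` is. [folklore] -/
theorem comp_dilate_eventuallyEq_one {χ : ℂ → ℂ} {c : ℂ} (h1 : χ =ᶠ[𝓝 c] fun _ ↦ 1) :
    (fun s : ℂ ↦ χ (c + (2⁻¹ : ℝ) • (s - c))) =ᶠ[𝓝 c] fun _ ↦ 1 := by
  have hcont : Continuous fun s : ℂ ↦ c + (2⁻¹ : ℝ) • (s - c) := by fun_prop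
  have hc : (fun s : ℂ ↦ c + (2⁻¹ : ℝ) • (s - c)) c = c := by simp
  have ht : Tendsto (fun s : ℂ ↦ c + (2⁻¹ : ℝ) • (s - c)) (𝓝 c) (𝓝 c) := by
    simpa [hc] using hcont.tendsto c
  exact ht.eventually h1

/-- `∂̄` of the dilated cut-off: `∂̄(χ(c + (s - c)/2)) = ½ (∂̄χ)(c + (s - c)/2)` (chain rule with
the real-linear differential `½ · id`). [folklore] -/
theorem dbarAlong_comp_dilate {χ : ℂ → ℂ} (hχ : ContDiff ℝ 1 χ) (c s : ℂ) :
    dbarAlong 1 (fun s : ℂ ↦ χ (c + (2⁻¹ : ℝ) • (s - c))) s =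
      2⁻¹ * dbarAlong 1 χ (c + (2⁻¹ : ℝ) • (s - c)) := by
  set A : ℂ → ℂ := fun s ↦ c + (2⁻¹ : ℝ) • (s - c) with hA
  have hA' : HasFDerivAt A ((2⁻¹ : ℝ) • ContinuousLinearMap.id ℝ ℂ) s := by
    have h := ((hasFDerivAt_id (𝕜 := ℝ) s).sub_const c).const_smul (2⁻¹ : ℝ)
    have h' := h.const_add c
    simpa [hA] using h'
  have hχd : DifferentiableAt ℝ χ (A s) := hχ.differentiable one_ne_zero _
  have hcomp : fderiv ℝ (fun s ↦ χ (A s)) s =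
      (fderiv ℝ χ (A s)).comp ((2⁻¹ : ℝ) • ContinuousLinearMap.id ℝ ℂ) := by
    have := hχd.hasFDerivAt.comp s hA'
    exact this.fderiv
  rw [dbarAlong_one, dbarAlong_one, hcomp]
  simp only [ContinuousLinearMap.comp_apply, _root_.smul_apply,
    ContinuousLinearMap.id_apply, map_smul]
  rw [Complex.real_smul, Complex.real_smul]
  push_cast
  ring

/-- **Dilating the cut-off multiplies the pairing with `(s - c)^m` by `2^{m+1}`**:
`∫ ∂̄(χ(c + (s-c)/2)) (s - c)^m dA = 2^{m+1} ∫ ∂̄χ (s - c)^m dA` (chain rule and the change of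
variables `s = c + 2w`, `dA(s) = 4 dA(w)`). [folklore] -/
theorem integral_dbarAlong_comp_dilate_mul_zpow {χ : ℂ → ℂ} (hχ : ContDiff ℝ 1 χ) (c : ℂ)
    (m : ℤ) :
    ∫ s, dbarAlong 1 (fun s : ℂ ↦ χ (c + (2⁻¹ : ℝ) • (s - c))) s * (s - c) ^ m =
      (2 : ℂ) ^ (m + 1) * ∫ s, dbarAlong 1 χ s * (s - c) ^ m := by
  set F : ℂ → ℂ := fun w ↦ dbarAlong 1 χ w * (w - c) ^ m with hF
  have h2 : (2 : ℂ) ≠ 0 := two_ne_zero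
  -- pointwise: the integrand is `2⁻¹ 2^m F(c + (s - c)/2)`
  have hpt : ∀ s : ℂ, dbarAlong 1 (fun s : ℂ ↦ χ (c + (2⁻¹ : ℝ) • (s - c))) s * (s - c) ^ m =
      (2 : ℂ)⁻¹ * (2 : ℂ) ^ m * F (c + (2⁻¹ : ℝ) • (s - c)) := by
    intro s
    rw [dbarAlong_comp_dilate hχ c s, hF]
    simp only
    have hw : c + (2⁻¹ : ℝ) • (s - c) - c = (2 : ℂ)⁻¹ * (s - c) := by
      rw [Complex.real_smul]; push_cast; ring
    rw [hw, mul_zpow]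
    have : (2 : ℂ) ^ m * (2 : ℂ)⁻¹ ^ m = 1 := by
      rw [← mul_zpow, mul_inv_cancel₀ h2, one_zpow]
    linear_combination (-((2 : ℂ)⁻¹ * dbarAlong 1 χ (c + (2⁻¹ : ℝ) • (s - c)) * (s - c) ^ m)) *
      this
  have hfun : (fun s : ℂ ↦ dbarAlong 1 (fun s : ℂ ↦ χ (c + (2⁻¹ : ℝ) • (s - c))) s * (s - c) ^ m)
      = fun s ↦ (2 : ℂ)⁻¹ * (2 : ℂ) ^ m * F (c + (2⁻¹ : ℝ) • (s - c)) := funext hpt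
  rw [hfun, integral_const_mul]
  -- change of variables
  have hcv : ∫ s : ℂ, F (c + (2⁻¹ : ℝ) • (s - c)) = 4 * ∫ w, F w := by
    have ht1 : ∫ s : ℂ, F (c + (2⁻¹ : ℝ) • (s - c)) = ∫ s : ℂ, F (c + (2⁻¹ : ℝ) • s) :=
      integral_sub_right_eq_self (fun s : ℂ ↦ F (c + (2⁻¹ : ℝ) • s)) c
    have ht2 := Measure.integral_comp_smul (volume : Measure ℂ) (fun s : ℂ ↦ F (c + s)) (2⁻¹ : ℝ)
    have ht3 : ∫ s : ℂ, F (c + s) = ∫ w, F w := integral_add_left_eq_self F c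
    rw [ht1, ht2, ht3, Complex.finrank_real_complex]
    norm_num
  rw [hcv, zpow_add₀ h2, zpow_one]
  ring

/-- **`∫ ∂̄χ (s - c)^m dA = 0` for `m ≠ -1`** (`χ ∈ C¹_c`, `χ = 1` near `c`): the integral is
unchanged when `χ` is replaced by the dilated cut-off (`integral_dbarAlong_mul_zpow_sub_eq`), and
is thereby multiplied by `2^{m+1} ≠ 1`. (For `m ≥ 0` this is also (1.2.5) with `u = (z-c)^{m+1}`;
for `m ≤ -2` it is the vanishing behind "differentiation of (1.2.5)".)
[cite: HormanderSCV1973, proof of Thm. 1.2.4, (1.2.5)] -/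
theorem integral_dbarAlong_mul_zpow_sub_eq_zero {χ : ℂ → ℂ} {c : ℂ} (hχ : ContDiff ℝ 1 χ)
    (hχc : HasCompactSupport χ) (h1 : χ =ᶠ[𝓝 c] fun _ ↦ 1) {m : ℤ} (hm : m ≠ -1) :
    ∫ s, dbarAlong 1 χ s * (s - c) ^ m = 0 := by
  set I₀ := ∫ s, dbarAlong 1 χ s * (s - c) ^ m with hI₀
  have heq := integral_dbarAlong_mul_zpow_sub_eq (contDiff_comp_dilate hχ c)
    (hasCompactSupport_comp_dilate hχc c) (comp_dilate_eventuallyEq_one h1) hχ hχc h1 m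
  rw [integral_dbarAlong_comp_dilate_mul_zpow hχ c m] at heq
  -- `2^{m+1} I₀ = I₀` with `2^{m+1} ≠ 1`
  have hne : (2 : ℂ) ^ (m + 1) ≠ 1 := by
    have hm' : m + 1 ≠ 0 := fun h ↦ hm (by omega)
    rw [show (2 : ℂ) = ((2 : ℝ) : ℂ) by norm_num, ← ofReal_zpow, ne_eq, ofReal_eq_one]
    exact fun h ↦ hm' ((zpow_right_inj₀ (by norm_num : (0 : ℝ) < 2) (by norm_num)).1
      (h.trans (zpow_zero (2 : ℝ)).symm))
  have h' : ((2 : ℂ) ^ (m + 1) - 1) * I₀ = 0 := by rw [sub_mul, one_mul, heq, sub_self]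
  rcases mul_eq_zero.1 h' with h | h
  · exact absurd (sub_eq_zero.1 h) hne
  · exact h

/-- **`∫ ∂̄χ (s - c)⁻¹ dA = -π`** for a cut-off `χ ∈ C¹_c` with `χ = 1` near `c`
(Cauchy–Pompeiu at `c`). [cite: HormanderSCV1973, Thm. 1.2.1] -/
theorem integral_dbarAlong_mul_inv_sub_eq_neg_pi {χ : ℂ → ℂ} {c : ℂ} (hχ : ContDiff ℝ 1 χ)
    (hχc : HasCompactSupport χ) (h1 : χ =ᶠ[𝓝 c] fun _ ↦ 1) :
    ∫ s, dbarAlong 1 χ s * (s - c)⁻¹ = -π := by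
  rw [integral_dbarAlong_mul_inv_sub_eq hχ hχc c, show χ c = 1 from h1.self_of_nhds, mul_one]

/-! ### The main formula -/

/-- **Pairing `∂̄χ` against a meromorphic function computes the residue.** Let `χ ∈ C¹_c(ℂ)` with
`supp χ ⊆ U` open and `χ = 1` on a neighbourhood of `c ∈ U`, and let `f` be holomorphic on
`U ∖ {c}` and meromorphic at `c`. Then `∫_ℂ ∂̄χ · f dA = -π · Res_c f`. (Split off the principal
part `∑ b_k (z - c)^{-(k+1)}` of `f` at `c`; the term `k = 0` gives `-π b₀` by Cauchy–Pompeiu, the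
terms `k ≥ 1` vanish, and `f -` (principal part) extends holomorphically across `c`, so pairs to
zero: Hörmander's (1.2.5) and its derivatives.) [cite: HormanderSCV1973, Thm. 1.2.1 and proof of Thm. 1.2.4, (1.2.5)] -/
theorem integral_dbarAlong_mul_eq_neg_pi_mul_residueAt {χ f : ℂ → ℂ} {c : ℂ} {U : Set ℂ}
    (hU : IsOpen U) (hcU : c ∈ U) (hχ : ContDiff ℝ 1 χ) (hχc : HasCompactSupport χ)
    (hχU : tsupport χ ⊆ U) (h1 : χ =ᶠ[𝓝 c] fun _ ↦ 1) (hf : DifferentiableOn ℂ f (U \ {c}))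
    (hfm : MeromorphicAt f c) :
    ∫ s, dbarAlong 1 χ s * f s = -π * residueAt f c := by
  obtain ⟨m, b, G, hG, hfG⟩ := exists_principalPart hfm
  rw [residueAt_eq_of_principalPart hG hfG]
  -- the principal part `P` and the regular part `G'` (`= f - P` off `c`, `= G c` at `c`)
  set P : ℂ → ℂ := fun z ↦ ∑ k ∈ Finset.range m, b k * (z - c) ^ (-(k + 1 : ℤ)) with hP
  set G' : ℂ → ℂ := fun z ↦ if z = c then G c else f z - P z with hG'
  have hPd : ∀ z, z ≠ c → DifferentiableAt ℂ P z := fun z hz ↦ by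
    simp only [hP]
    exact DifferentiableAt.fun_sum fun k _ ↦ (differentiableAt_zpow_sub hz _).const_mul _
  have hG'G : G' =ᶠ[𝓝 c] G := by
    have h' : ∀ᶠ z in 𝓝 c, z ≠ c → f z = P z + G z := eventually_nhdsWithin_iff.1 hfG
    filter_upwards [h'] with z hz
    by_cases hzc : z = c
    · simp [hG', hzc]
    · simp only [hG', hzc, if_false]
      rw [hz hzc]; ring
  have hG'c : AnalyticAt ℂ G' c := hG.congr hG'G.symm
  have hG'd : DifferentiableOn ℂ G' U := by
    intro z hz
    by_cases hzc : z = c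
    · subst hzc
      exact hG'c.differentiableAt.differentiableWithinAt
    · have hfz : DifferentiableAt ℂ f z :=
        hf.differentiableAt ((hU.sdiff isClosed_singleton).mem_nhds ⟨hz, hzc⟩)
      have heq : G' =ᶠ[𝓝 z] fun z ↦ f z - P z := by
        filter_upwards [isOpen_compl_singleton.mem_nhds hzc] with w hw
        simp only [hG', mem_compl_iff, mem_singleton_iff] at hw ⊢
        simp [hw]
      exact ((hfz.sub (hPd z hzc)).congr_of_eventuallyEq heq).differentiableWithinAt
  -- `∂̄χ · f = ∂̄χ · (P + G')` everywhere
  have hsplit : ∀ s, dbarAlong 1 χ s * f s =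
      (∑ k ∈ Finset.range m, b k * (dbarAlong 1 χ s * (s - c) ^ (-(k + 1 : ℤ)))) +
        dbarAlong 1 χ s * G' s := by
    intro s
    by_cases hsU : s ∈ U
    · by_cases hsc : s = c
      · subst hsc
        have h0 : dbarAlong 1 χ s = 0 :=
          (dbarAlong_eventuallyEq_zero_of_eventuallyEq_const h1).self_of_nhds
        simp [h0]
      · have hfs : f s = P s + G' s := by simp [hG', hsc]
        rw [hfs, mul_add, hP]
        simp only [Finset.mul_sum]
        congr 1
        refine Finset.sum_congr rfl fun k _ ↦ ?_
        ring
    · rw [dbarAlong_eq_zero_of_notMem hχU hsU]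
      simp
  have hfun : (fun s ↦ dbarAlong 1 χ s * f s) = fun s ↦
      (∑ k ∈ Finset.range m, b k * (dbarAlong 1 χ s * (s - c) ^ (-(k + 1 : ℤ)))) +
        dbarAlong 1 χ s * G' s := funext hsplit
  -- integrability of the pieces
  have hintk : ∀ k : ℕ,
      Integrable fun s ↦ b k * (dbarAlong 1 χ s * (s - c) ^ (-(k + 1 : ℤ))) := fun k ↦
    (integrable_dbarAlong_mul hχ hχc h1 (continuousOn_zpow_sub_compl c _)).const_mul _
  have hintG : Integrable fun s ↦ dbarAlong 1 χ s * G' s :=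
    (continuous_dbarAlong_mul_of_tsupport_subset hU hχ hχU hG'd.continuousOn)
      |>.integrable_of_hasCompactSupport (hasCompactSupport_dbarAlong_mul hχc G')
  rw [hfun, integral_add (integrable_finsetSum _ fun k _ ↦ hintk k) hintG,
    integral_finsetSum _ fun k _ ↦ hintk k,
    integral_dbarAlong_mul_eq_zero_of_differentiableOn hU hχ hχc hχU hG'd, add_zero]
  have hk : ∀ k ∈ Finset.range m,
      ∫ s, b k * (dbarAlong 1 χ s * (s - c) ^ (-(k + 1 : ℤ))) =
        if k = 0 then -π * b 0 else 0 := by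
    intro k _
    rw [integral_const_mul]
    split_ifs with hk0
    · subst hk0
      simp only [Nat.cast_zero, zero_add, zpow_neg, zpow_one]
      rw [integral_dbarAlong_mul_inv_sub_eq_neg_pi hχ hχc h1]
      ring
    · have hne : (-(k + 1 : ℤ)) ≠ -1 := by omega
      rw [integral_dbarAlong_mul_zpow_sub_eq_zero hχ hχc h1 hne, mul_zero]
  rw [Finset.sum_congr rfl hk]
  split_ifs with hm
  · rw [Finset.sum_ite_eq' (Finset.range m) 0 (fun _ ↦ -↑π * b 0)]
    simp [hm]
  · simp only [not_lt, Nat.le_zero] at hm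
    subst hm
    simp

end Literature.Analysis.Complex

end
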